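import Mathlib

/-!
# The primitive of the inner `V`-source of the packing resolvent: existence, derivative and the bound `|H| ≤ 0.7N`
# (crux `DenseExcursion`, stmt-AtomisticToContinuum-12586, line `sonic-cavity-renewal` v8, stub `stub_packingResolventW`)

Helper file (`--supports stmt-AtomisticToContinuum-12586`) for the registered stub `stub_packingResolventW` (skeleton v8;
registered helper here: `packingResolventW_innerPrimitive`). In the acoustic normal form `u₁′ = a₁₁u₁ + a₁₂V + h₁`,
`V′ = a₂₁u₁ + a₂₂V + h₂` of the inner region `x ≤ x_Λ` (landed `inner_normal_form`), the `V`-source `h₂` (which contains the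
large component `f₁` of a `(1 + S)`-weighted source) is removed WITHOUT DIFFERENTIATING IT by passing to `Ṽ = V − H`,
`H(x) = ∫_{x_Λ}^{x} h₂`: this file supplies `H` — for a function `h` continuous on the core `x < 0` with the envelope
`|h| ≤ N(17ρ/50 + ρ²/100)`, `ρ = ceˣ ≤ 2` on `x ≤ x_Λ` (landed `inner_h2_bound`), the primitive `u ↦ ∫_{x_Λ}^{u} h`
vanishes at `x_Λ`, has derivative `h` on `x ≤ x_Λ` (FTC), and is bounded by `N(17/50·2 + 2²/200) = 0.7N` there
(`∫_{−∞}^{x_Λ} ρ = ρ(x_Λ)`, `∫ ρ² = ρ(x_Λ)²/2`). Mathlib's interval-integral FTC; nothing else.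
-/

noncomputable section

open Set Filter MeasureTheory intervalIntegral
open scoped Topology

namespace Summit.AtomisticToContinuum.HydrodynamicLimit.Theorems.PackingAnalyticImplosion

/-- **Registered helper `packingResolventW_innerPrimitive` of `stub_packingResolventW`: THE PRIMITIVE OF THE INNER
`V`-SOURCE.** For `h` continuous on `x < 0`, `x_Λ < 0`, `c > 0` with `ce^{x_Λ} ≤ 2`, and `|h x| ≤ N(17ce^x/50 + (ce^x)²/100)`
on `x ≤ x_Λ`: the primitive `H u = ∫_{x_Λ}^{u} h` has `H′ = h` and `|H| ≤ (7/10)N` on `x ≤ x_Λ`, and `H(x_Λ) = 0`. [folklore] -/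
theorem packingResolventW_innerPrimitive : ∀ (h : ℝ → ℝ) (xL c N : ℝ), xL < 0 → 0 < c → c * Real.exp xL ≤ 2 → 0 ≤ N → ContinuousOn h (Set.Iio 0) → (∀ x, x ≤ xL → |h x| ≤ N * (17 / 50 * (c * Real.exp x) + (c * Real.exp x) ^ 2 / 100)) → (∀ x, x ≤ xL → HasDerivAt (fun u => ∫ t in xL..u, h t) (h x) x ∧ |∫ t in xL..x, h t| ≤ 7 / 10 * N) ∧ (∫ t in xL..xL, h t) = 0 := by
  intro h xL c N hxL hc hρL hN hcont hbound
  refine ⟨fun x hx => ⟨?_, ?_⟩, integral_same⟩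
  · -- FTC at `x ≤ x_Λ < 0`
    have hx0 : x < 0 := lt_of_le_of_lt hx hxL
    have hsub : uIcc xL x ⊆ Iio 0 := by
      rw [uIcc_of_ge hx]
      exact fun t ht => lt_of_le_of_lt ht.2 hxL
    have hint : IntervalIntegrable h volume xL x := (hcont.mono hsub).intervalIntegrable
    have hmeas : StronglyMeasurableAtFilter h (𝓝 x) volume :=
      ContinuousOn.stronglyMeasurableAtFilter isOpen_Iio hcont x hx0
    have hxc : ContinuousAt h x := hcont.continuousAt (Iio_mem_nhds hx0)
    exact integral_hasDerivAt_right hint hmeas hxc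
  · -- the bound: `|∫_{x_Λ}^{x} h| = |∫_{x}^{x_Λ} h| ≤ G(x_Λ) − G(x) ≤ G(x_Λ) ≤ 0.7 N`
    have hx0 : x < 0 := lt_of_le_of_lt hx hxL
    set g : ℝ → ℝ := fun t => N * (17 / 50 * (c * Real.exp t) + (c * Real.exp t) ^ 2 / 100) with hg
    set G : ℝ → ℝ := fun t => N * (17 / 50 * (c * Real.exp t) + c ^ 2 * (Real.exp t * Real.exp t) / 200) with hG
    have hGd : ∀ t, HasDerivAt G (g t) t := by
      intro t
      have h1 : HasDerivAt (fun y => Real.exp y * Real.exp y) (Real.exp t * Real.exp t + Real.exp t * Real.exp t) t :=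
        (Real.hasDerivAt_exp t).mul (Real.hasDerivAt_exp t)
      have h2 : HasDerivAt G (N * (17 / 50 * (c * Real.exp t) +
          c ^ 2 * (Real.exp t * Real.exp t + Real.exp t * Real.exp t) / 200)) t :=
        ((((Real.hasDerivAt_exp t).const_mul c).const_mul (17 / 50)).add ((h1.const_mul (c ^ 2)).div_const 200)).const_mul N
      refine h2.congr_deriv ?_
      simp only [hg]; ring
    have hsub : uIcc x xL ⊆ Iio 0 := by
      rw [uIcc_of_le hx]
      exact fun t ht => lt_of_le_of_lt ht.2 hxL
    have hgc : Continuous g := by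
      simp only [hg]; fun_prop
    have hint_g : IntervalIntegrable g volume x xL := hgc.intervalIntegrable x xL
    have hFTC : ∫ t in x..xL, g t = G xL - G x :=
      integral_eq_sub_of_hasDerivAt (fun t _ => hGd t) hint_g
    -- `‖∫_x^{xL} h‖ ≤ |∫ g|`
    have hle : ‖∫ t in x..xL, h t‖ ≤ ∫ t in x..xL, g t := by
      refine norm_integral_le_of_norm_le hx (Eventually.of_forall fun t ht => ?_) hint_g
      have ht' : t ≤ xL := ht.2
      rw [Real.norm_eq_abs]
      exact hbound t ht'
    -- evaluate
    have hGx : 0 ≤ G x := by simp only [hG]; positivity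
    have hGL : G xL ≤ 7 / 10 * N := by
      simp only [hG]
      have h0 : 0 ≤ c * Real.exp xL := by positivity
      have h2 : 17 / 50 * (c * Real.exp xL) + c ^ 2 * (Real.exp xL * Real.exp xL) / 200 ≤ 7 / 10 := by
        have h3 : c ^ 2 * (Real.exp xL * Real.exp xL) = (c * Real.exp xL) * (c * Real.exp xL) := by ring
        rw [h3]
        nlinarith
      calc N * (17 / 50 * (c * Real.exp xL) + c ^ 2 * (Real.exp xL * Real.exp xL) / 200) ≤ N * (7 / 10) :=
            mul_le_mul_of_nonneg_left h2 hN
        _ = 7 / 10 * N := by ring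
    have hGmono : G x ≤ G xL := by
      simp only [hG]
      have h1 : Real.exp x ≤ Real.exp xL := Real.exp_le_exp.2 hx
      have h2 : Real.exp x * Real.exp x ≤ Real.exp xL * Real.exp xL :=
        mul_le_mul h1 h1 (Real.exp_pos x).le (Real.exp_pos xL).le
      have h3 : c * Real.exp x ≤ c * Real.exp xL := mul_le_mul_of_nonneg_left h1 hc.le
      have h4 : c ^ 2 * (Real.exp x * Real.exp x) ≤ c ^ 2 * (Real.exp xL * Real.exp xL) :=
        mul_le_mul_of_nonneg_left h2 (by positivity)
      have h5 : 17 / 50 * (c * Real.exp x) + c ^ 2 * (Real.exp x * Real.exp x) / 200 ≤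
          17 / 50 * (c * Real.exp xL) + c ^ 2 * (Real.exp xL * Real.exp xL) / 200 := by linarith
      exact mul_le_mul_of_nonneg_left h5 hN
    rw [integral_symm, abs_neg]
    rw [hFTC, Real.norm_eq_abs] at hle
    linarith

end Summit.AtomisticToContinuum.HydrodynamicLimit.Theorems.PackingAnalyticImplosion

end
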